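import Literature.AlgebraicGeometry.Resolution.NormalizationInExtension
import Literature.AlgebraicGeometry.Resolution.Temkin2008LocalizationProofs
import Literature.AlgebraicGeometry.Resolution.Principalization
import Literature.AlgebraicGeometry.Resolution.NonPrincipalLocus
import Literature.AlgebraicGeometry.Resolution.RegularBlowup
import Literature.AlgebraicGeometry.Resolution.RegularCentreBlowupSeqIntegral
import Literature.AlgebraicGeometry.Resolution.GeneralLU
import Literature.AlgebraicGeometry.Resolution.QuasiExcellentField
import Literature.AlgebraicGeometry.Resolution.ExcellentRingsEssFiniteType
import Literature.AlgebraicGeometry.Resolution.ExcellentRingsFieldProofs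
import Literature.AlgebraicGeometry.Morphisms.NagataCompactificationProofs
import Literature.AlgebraicGeometry.Resolution.BlowupsExistence
import Literature.AlgebraicGeometry.Resolution.BlowupsLocal
import Literature.AlgebraicGeometry.Resolution.AlterationsResolution
import Literature.AlgebraicGeometry.Resolution.PrincipalizationToResolution
import Literature.AlgebraicGeometry.Motives.AbelianVarietyIsogenyProofs
import Literature.AlgebraicGeometry.Resolution.BlowupReducedDimension

/-!
# STUB-PLAN sketch for `stub_picoverDegP` (crux `Picover`, stmt-ResolutionOfSingularities-0554)

Stub critic's merged plan, TYPED AND PROVED: every helper lemma below (H1–H4) is sorry-free and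
the assembly `stub_picoverDegP_of_kernel` depends only on `propext`, `Classical.choice`,
`Quot.sound`; the ONE `sorry` of the file is the research kernel `stub_picoverKernel`.
See `STUB-PLAN-stub_picoverDegP.md`.

Frame = Temkin's localisation of desingularization in BLOW-UP form (the Noetherian induction is
already proved in tree, `temkin2008_prop234_of_comp`), local hypothesis discharged at every
singular point of local dimension `≤ 3` from the in-tree named facts `CossartPiltant2019General`
(Thm. 1.1) + `CossartPiltant2019Principalization` (Prop. 4.4) + Raynaud–Gruson domination
(`exists_isBlowup_dominating`, proved in tree) — and in local dimension `≤ 2` from the blow-up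
clause of CJS 2020 Thm. 1.2 (fact request `CossartJannsenSaito2020Desing` below). What is left is
the KERNEL `PicoverKernel p`: Temkin's local hypothesis at the singular points of local dimension
`≥ 4` of `W^L` (for `dim W = 4`: the singular closed points) — the literature's open problem
(Cossart–Piltant 2019 "test case", `h = X^p + f`, `n ≥ 4`).
-/

noncomputable section

open CategoryTheory CategoryTheory.Limits AlgebraicGeometry TopologicalSpace IsLocalRing
open Literature.AlgebraicGeometry.Resolution Literature.AlgebraicGeometry.Morphisms

set_option linter.dupNamespace false

namespace Summit.ResolutionOfSingularities.ResolutionOfSingularities.Cruxes.Picover.StubPlan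

universe u

/-! ## F — fact request (re-vendoring of an already-cited printed theorem, blow-up clause) -/

/-- FACT REQUEST `CossartJannsenSaito2020Desing` — **Cossart–Jannsen–Saito 2020, Thm. 1.2 with
its blow-up clause** ("there exists a canonical finite sequence … `X_{i+1} → X_i` is the blow-up
of `X_i` in a permissible center `D_i ⊂ X_i` which is contained in `(X_i)_sing` … `X'` regular"),
packaged (Raynaud, `IsBlowup.exists_isBlowup_comp_supported`; the centres lie over `X_sing`
because each `X_i → X` is an isomorphism over `X_reg`) as: every reduced excellent Noetherian
scheme of dimension `≤ 2` admits a desingularization in Temkin's sense (a `Sing`-supported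
blow-up with regular source). The tree's `CossartJannsenSaito2020General` keeps only the weak
"proper, iso over `Reg`" conclusion. -/
def CossartJannsenSaito2020Desing : Prop :=
  ∀ (X : Scheme.{u}) [IsNoetherian X] [IsReduced X],
    Scheme.IsExcellent X → topologicalKrullDim X ≤ 2 → Scheme.AdmitsDesingularization X

/-! ## H1 — per-scheme Temkin localisation (copy of the in-tree induction) -/

/-- **H1 — PROVED.** Temkin 2008 Prop. 2.3.4 (iii)⇒(ii) for ONE scheme: the in-tree proof
`temkin2008_prop234_of_comp` (fed with `IsBlowup.exists_isBlowup_comp_supported`) applies its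
local hypothesis only at (maximal, hence singular) points of the given `X`; copy it with `hloc`
restricted to the singular points of `X` (transplanted verbatim below). -/
theorem admitsDesingularization_of_localBlowups {B X : Scheme.{u}} [IsNoetherian B]
    (hB : Scheme.IsQuasiExcellent B) (f₀ : X ⟶ B) [IsIntegral X] [LocallyOfFiniteType f₀]
    [QuasiCompact f₀]
    (hloc : ∀ x : X, x ∉ Scheme.regularLocus X → ∀ (S' : Scheme.{u})
      (g : S' ⟶ Spec (X.presheaf.stalk x)) (I : (Spec (X.presheaf.stalk x)).IdealSheafData),
      IsBlowup g I →
      (∀ s : S', s ∉ Scheme.regularLocus S' → g s = closedPoint (X.presheaf.stalk x)) →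
      Scheme.AdmitsDesingularization S') :
    Scheme.AdmitsDesingularization X := by
  -- `X` is a Noetherian scheme, its singular locus `T` is closed
  haveI : IsLocallyNoetherian X := LocallyOfFiniteType.isLocallyNoetherian f₀
  haveI : CompactSpace X := QuasiCompact.compactSpace_of_compactSpace f₀
  haveI : IsNoetherian X := {}
  set T : Set X := (Scheme.regularLocus X)ᶜ with hT
  have hTc : IsClosed T := isClosed_compl_regularLocus_of_locallyOfFiniteType f₀ hB
  -- the induction statement
  suffices H : ∀ C : Closeds X, (C : Set X) ⊆ T →
      (∃ (X' : Scheme.{u}) (f : X' ⟶ X) (J : X.IdealSheafData), IsBlowup f J ∧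
        (J.support : Set X) ⊆ T ∧ ∀ x' : X', f x' ∉ C → x' ∈ Scheme.regularLocus X') →
      Scheme.AdmitsDesingularization X by
    refine H ⟨T, hTc⟩ subset_rfl ⟨X, 𝟙 X, ⊤, isBlowup_id_top X, ?_, fun x' hx' => ?_⟩
    · simp [Scheme.IdealSheafData.support_top]
    · simpa [hT] using hx'
  intro C
  induction C using WellFoundedLT.induction with
  | ind C ih =>
  intro hCT ⟨X', f, J, hf, hJ, hreg⟩
  -- either `X'` is already regular …
  by_cases hall : ∀ x' : X', x' ∈ Scheme.regularLocus X'
  · exact ⟨X', f, ⟨J, hf, hJ⟩, fun x' => (Scheme.mem_regularLocus x').mp (hall x')⟩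
  -- … or `C` is nonempty; pick a maximal point `x` of `C`
  push Not at hall
  obtain ⟨x₁, hx₁⟩ := hall
  have hx₁C : f x₁ ∈ (C : Set X) := by
    by_contra h
    exact hx₁ (hreg x₁ h)
  obtain ⟨x, hxC, hmax⟩ := exists_maximal_point_of_isClosed C.isClosed hx₁C
  -- `X'` is Noetherian, of finite type over `k`
  haveI : IsProper f := hf.isProper
  haveI : IsLocallyNoetherian X' := LocallyOfFiniteType.isLocallyNoetherian f
  haveI : CompactSpace X' := QuasiCompact.compactSpace_of_compactSpace f
  haveI : IsNoetherian X' := {}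
  -- the local scheme `S = Spec 𝒪_{X,x}` and the pro-open pro-subscheme `S' = X' ×_X S` of `X'`
  haveI : Flat (X.fromSpecStalk x) := flat_fromSpecStalk X x
  haveI : IsNoetherian (pullback f (X.fromSpecStalk x)) := {}
  have hgb : IsBlowup (pullback.snd f (X.fromSpecStalk x)) (J.comap (X.fromSpecStalk x)) :=
    hf.pullback_snd_of_flat (X.fromSpecStalk x)
  have hfj : ∀ s : ↑(pullback f (X.fromSpecStalk x)),
      f (pullback.fst f (X.fromSpecStalk x) s) =
        X.fromSpecStalk x (pullback.snd f (X.fromSpecStalk x) s) := fun s => by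
    rw [← Scheme.Hom.comp_apply, pullback.condition, Scheme.Hom.comp_apply]
  -- `S'_sing ⊆ g⁻¹(s)`: a singular point of `S'` is singular in `X'`, hence lies over `C`, over a
  -- generization of `x`, hence over `x` by maximality
  have hsing : ∀ s : ↑(pullback f (X.fromSpecStalk x)),
      s ∉ Scheme.regularLocus (pullback f (X.fromSpecStalk x)) →
        pullback.snd f (X.fromSpecStalk x) s = closedPoint (X.presheaf.stalk x) := by
    intro s hs
    have h1 : pullback.fst f (X.fromSpecStalk x) s ∉ Scheme.regularLocus X' := fun h =>
      hs ((mem_regularLocus_iff_pullback_fst_fromSpecStalk f x s).mpr h)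
    have h2 : f (pullback.fst f (X.fromSpecStalk x) s) ∈ (C : Set X) := by
      by_contra h
      exact h1 (hreg _ h)
    have h3 : X.fromSpecStalk x (pullback.snd f (X.fromSpecStalk x) s) ⤳ x :=
      Scheme.range_fromSpecStalk.le ⟨_, rfl⟩
    have h4 : X.fromSpecStalk x (pullback.snd f (X.fromSpecStalk x) s) = x :=
      hmax _ (hfj s ▸ h2) h3
    apply (X.fromSpecStalk x).isEmbedding.injective
    rw [h4, Scheme.fromSpecStalk_closedPoint]
  -- the local desingularization provided by condition (iii)
  obtain ⟨S'', g', hdes⟩ := hloc x (fun h => (hCT hxC) h) (pullback f (X.fromSpecStalk x))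
    (pullback.snd f (X.fromSpecStalk x)) (J.comap (X.fromSpecStalk x)) hgb hsing
  obtain ⟨I', hg', hI'⟩ := hdes.exists_isBlowup
  have hS''reg := hdes.isRegular
  -- extend its centre to `X'` (Lemma 2.1.1) and blow `X'` up along the extension
  obtain ⟨J', hJ'I', hJ'supp⟩ := exists_idealSheaf_extension_fromSpecStalk f x I'
  obtain ⟨X'', f', hf'⟩ := exists_isBlowup X' J'
  -- the new centre lies over the closure of `x`, inside `C ⊆ T`
  have hIx : ∀ s ∈ (I'.support : Set ↑(pullback f (X.fromSpecStalk x))),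
      f (pullback.fst f (X.fromSpecStalk x) s) = x := fun s hs => by
    rw [hfj, hsing s (hI' hs), Scheme.fromSpecStalk_closedPoint]
  have hJ'C : f '' (J'.support : Set X') ⊆ (C : Set X) := by
    rw [hJ'supp]
    refine (image_closure_subset_closure_image f.continuous).trans ?_
    refine C.isClosed.closure_subset_iff.mpr ?_
    rintro _ ⟨_, ⟨s, hs, rfl⟩, rfl⟩
    rw [hIx s hs]
    exact hxC
  have hJ'T : (J'.support : Set X') ⊆ f ⁻¹' T := fun x' hx' => hCT (hJ'C ⟨x', hx', rfl⟩)
  -- so the composite is a `T`-supported blow-up of `X` (Lemma 2.1.4)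
  obtain ⟨J₂, hf₂, hJ₂⟩ := hf.exists_isBlowup_comp_supported f J f' J' T hJ hf' hJ'T
  -- `X''` is of finite type over `k`: its singular locus is closed, with closed image `C'`
  haveI : IsProper f' := hf'.isProper
  have hreg'' : IsClosed (Scheme.regularLocus X'')ᶜ :=
    isClosed_compl_regularLocus_of_locallyOfFiniteType ((f' ≫ f) ≫ f₀) hB
  let C' : Closeds X :=
    ⟨(f' ≫ f) '' (Scheme.regularLocus X'')ᶜ, (f' ≫ f).isClosedMap _ hreg''⟩
  -- `C' ⊆ C ∖ {x}`
  have hC'C : (C' : Set X) ⊆ (C : Set X) \ {x} := by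
    rintro _ ⟨x'', hx'', rfl⟩
    refine ⟨?_, ?_⟩
    · -- over `X ∖ C`: `X'` is regular there and `f'` is an isomorphism off its centre
      by_contra hy
      have hy' : f (f' x'') ∉ (C : Set X) := by rwa [Scheme.Hom.comp_apply] at hy
      have h1 : f' x'' ∈ Scheme.regularLocus X' := hreg _ hy'
      have h2 : f' x'' ∉ (J'.support : Set X') := fun h => hy' (hJ'C ⟨_, h, rfl⟩)
      haveI := hf'.isIso_compl
      exact hx'' ((mem_regularLocus_iff_of_isIso_morphismRestrict f'
        ⟨(J'.support : Set X')ᶜ, J'.support.isClosed.isOpen_compl⟩ x'' h2).mpr h1)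
    · -- over `x`: `X'' ×_{X'} S'` is the regular scheme `S''` (flat base change, uniqueness)
      intro hyx
      rw [Set.mem_singleton_iff, Scheme.Hom.comp_apply] at hyx
      obtain ⟨s, hs⟩ := mem_range_pullback_fst_fromSpecStalk_of_eq f x hyx
      have hT' : IsBlowup (pullback.snd f' (pullback.fst f (X.fromSpecStalk x))) I' := by
        rw [← hJ'I']
        exact hf'.pullback_snd_of_flat _
      obtain ⟨e, -, -⟩ := hT'.unique hg'
      have hx''range : x'' ∈ Set.range (pullback.fst f' (pullback.fst f (X.fromSpecStalk x))) := by
        rw [Scheme.Pullback.range_fst]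
        exact ⟨s, hs⟩
      obtain ⟨t, rfl⟩ := hx''range
      apply hx''
      refine (mem_regularLocus_iff_of_flat_of_isPreimmersion _ t).mp ?_
      exact (mem_regularLocus_iff_of_flat_of_isPreimmersion e.hom t).mpr (hS''reg _)
  have hlt : C' < C := by
    refine lt_of_le_of_ne (fun y hy => (hC'C hy).1) fun h => ?_
    have hx' : x ∈ (C' : Set X) := by
      rw [h]
      exact hxC
    exact (hC'C hx').2 rfl
  exact ih C' hlt (fun y hy => hCT (hC'C hy).1)
    ⟨X'', f' ≫ f, J₂, hf₂, hJ₂, fun x'' hx'' => by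
      by_contra h
      exact hx'' ⟨x'', h, rfl⟩⟩

/-! ## H2 — a Cossart–Piltant regular-centre sequence is ONE blow-up supported in `Supp J` -/

/-- **H2 — PROVED.** Induction on `IsRegularCentreBlowupSeq` with
`IsBlowup.exists_isBlowup_comp_supported` (`T := Supp J`), `isBlowup_id_top`,
`nonPrincipalLocus_le_support`, `Scheme.IdealSheafData.support_comap`. -/
theorem exists_isBlowup_supported_of_isRegularCentreBlowupSeq' :
    ∀ {S' S : Scheme.{u}} {σ : S' ⟶ S} {J : S.IdealSheafData}, IsRegularCentreBlowupSeq σ J →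
      IsNoetherian S → ∃ Q : S.IdealSheafData, IsBlowup σ Q ∧ (Q.support : Set S) ⊆ J.support := by
  intro S' S σ J h
  induction h with
  | nil J =>
    intro _
    exact ⟨⊤, isBlowup_id_top _, by simp [Scheme.IdealSheafData.support_top]⟩
  | @cons S'' S' S τ σ J Y hσs hYint hYreg hY hτ ih =>
    intro hN
    haveI := hN
    obtain ⟨Q, hσ, hQ⟩ := ih hN
    have hYT : ((Scheme.IdealSheafData.vanishingIdeal Y).support : Set S') ⊆
        σ ⁻¹' (J.support : Set S) := by
      intro y hy
      rw [Scheme.IdealSheafData.coe_support_vanishingIdeal] at hy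
      have h1 : y ∈ nonPrincipalLocus (J.comap σ) := (mem_nonPrincipalLocus_iff _ _).mpr (hY y hy)
      have h2 : y ∈ (J.comap σ).support := nonPrincipalLocus_le_support _ h1
      rw [← SetLike.mem_coe, Scheme.IdealSheafData.support_comap] at h2
      exact h2
    obtain ⟨Q₂, hcomp, hQ₂⟩ :=
      hσ.exists_isBlowup_comp_supported σ Q τ _ (J.support : Set S) hQ hτ hYT
    exact ⟨Q₂, hcomp, hQ₂⟩

/-- **H2 (S) — PROVED above.** A Cossart–Piltant regular-centre sequence over a Noetherian scheme
is one blow-up along an ideal sheaf supported in `Supp J`. -/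
theorem exists_isBlowup_supported_of_isRegularCentreBlowupSeq {S' S : Scheme.{u}}
    [IsNoetherian S] {σ : S' ⟶ S} {J : S.IdealSheafData} (h : IsRegularCentreBlowupSeq σ J) :
    ∃ Q : S.IdealSheafData, IsBlowup σ Q ∧ (Q.support : Set S) ⊆ J.support :=
  exists_isBlowup_supported_of_isRegularCentreBlowupSeq' h inferInstance

/-! ## H3 — dimension three: CP 2019 Thm 1.1 + Prop 4.4 + Raynaud–Gruson ⇒ desingularization -/

/-- **H3c — PROVED.** A locally principal non-zero ideal sheaf on an integral scheme is effective
Cartier (its local generator is a non-zero-divisor). Cf. `isEffectiveCartier_of_openCover`,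
`isEffectiveCartier_of_forall_mem_nonZeroDivisors`, `not_mem_support_genericPoint`. -/
theorem isEffectiveCartier_of_isLocallyPrincipal {X : Scheme.{u}} [IsIntegral X]
    {K : X.IdealSheafData} (hK : IsLocallyPrincipal K) (hK0 : K ≠ ⊥) : IsEffectiveCartier K := by
  intro x
  obtain ⟨U, hxU, f, hf⟩ := hK x
  refine ⟨U, hxU, f, ?_, hf⟩
  haveI : Nonempty (U : X.Opens) := ⟨⟨x, hxU⟩⟩
  rw [mem_nonZeroDivisors_iff_ne_zero]
  intro hf0
  apply not_mem_support_genericPoint hK0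
  have hgen : genericPoint X ∈ (U : X.Opens) :=
    ((genericPoint_spec X).mem_open_set_iff (U : X.Opens).isOpen).mpr ⟨x, trivial, hxU⟩
  rw [Scheme.IdealSheafData.mem_support_iff_of_mem hgen, hf, hf0, Scheme.zeroLocus_span,
    Scheme.zeroLocus_singleton, Set.mem_compl_iff, Scheme.basicOpen_zero]
  exact fun h => h

/-- Schemes locally of finite type over an excellent ring are excellent (every affine open has a
coordinate ring of finite type over `A`; copy of
`Scheme.isQuasiExcellent_of_locallyOfFiniteType_of_isQuasiExcellentRing`). [Matsumura §32] -/
theorem isExcellent_of_locallyOfFiniteType_of_isExcellentRing {A : Type u} [CommRing A]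
    (hA : IsExcellentRing A) {X : Scheme.{u}} (f : X ⟶ Spec (.of A)) [LocallyOfFiniteType f] :
    Scheme.IsExcellent X := by
  intro U
  have hφ : RingHom.FiniteType (f.appLE ⊤ (U : X.Opens) le_top).hom :=
    HasRingHomProperty.appLE @LocallyOfFiniteType f ‹_› ⟨⊤, isAffineOpen_top _⟩ U le_top
  let e : A ≃+* Γ(Spec (.of A), ⊤) := (Scheme.ΓSpecIso (.of A)).commRingCatIsoToRingEquiv.symm
  have hψ : RingHom.FiniteType
      (((f.appLE ⊤ (U : X.Opens) le_top).hom : _ →+* _).comp e.toRingHom) :=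
    hφ.comp (RingHom.FiniteType.of_surjective _ e.surjective)
  letI : Algebra A Γ(X, U) :=
    ((((f.appLE ⊤ (U : X.Opens) le_top).hom : _ →+* _).comp e.toRingHom)).toAlgebra
  haveI : Algebra.FiniteType A Γ(X, U) := hψ
  exact hA.of_finiteType'

/-- The identity is a blow-up along any effective Cartier ideal sheaf. [folklore] -/
theorem isBlowup_id_of_isEffectiveCartier {X : Scheme.{u}} {K : X.IdealSheafData}
    (hK : IsEffectiveCartier K) : IsBlowup (𝟙 X) K where
  isEffectiveCartier := by simpa using hK
  universal := by
    intro W f _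
    exact ⟨f, Category.comp_id f, fun g hg => by simpa using hg⟩

/-- **H3b — PROVED.** Factoring one blow-up through another: if `σ : Z → X` is a blow-up along `Q`
pulling `J` back to an effective Cartier divisor and `r : S₁ → X` is a blow-up along `J`, then the
unique `t : Z → S₁` with `t ≫ r = σ` is a blow-up of `S₁` along `Q𝒪_{S₁}` (Stacks 080A twice:
`IsBlowup.comp` gives `Bl_{J·Q} X ≅ Bl_{Q𝒪} S₁` and `≅ Bl_{J𝒪} Z = Z`; `IsBlowup.unique`,
`IsBlowup.iso_comp`). -/
theorem exists_isBlowup_factor {Z S₁ X : Scheme.{u}} {σ : Z ⟶ X} {r : S₁ ⟶ X}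
    {Q J : X.IdealSheafData} (hσ : IsBlowup σ Q) (hr : IsBlowup r J)
    (hJ : IsEffectiveCartier (J.comap σ)) :
    ∃ t : Z ⟶ S₁, IsBlowup t (Q.comap r) ∧ t ≫ r = σ := by
  obtain ⟨B, t', ht'⟩ := exists_isBlowup S₁ (Q.comap r)
  have h1 : IsBlowup (t' ≫ r) (J * Q) := hr.comp ht'
  have h2 : IsBlowup (𝟙 Z ≫ σ) (Q * J) := hσ.comp (isBlowup_id_of_isEffectiveCartier hJ)
  rw [Category.id_comp, mul_comm] at h2
  obtain ⟨e, he, -⟩ := h2.unique h1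
  exact ⟨e.hom ≫ t', ht'.iso_comp e, by rw [Category.assoc, he]⟩

/-- **H3 — PROVED (the one new piece of known mathematics in the frame).** An integral 3-dimensional
scheme separated and of finite type over an excellent ring admits a desingularization
(`Sing`-supported blow-up with regular source). Proof: `π : X'' → S` from
`CossartPiltant2019General` (iso over `U = Reg S`); `exists_isBlowup_dominating π U` gives the
`U`-admissible blow-up `b : S₁ → S` along `I` (`Supp I = Sing S`) and `r : S₁ → X''`, a blow-up
along `I.comap π`; `CossartPiltant2019Principalization` on the regular excellent 3-fold `X''`
principalizes `I.comap π` by `σ : X_r → X''` (regular source, `IsRegularCentreBlowupSeq.isRegular`;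
one blow-up along `Q` with `Supp Q ⊆ π⁻¹(Sing S)`, H2); `σ` factors through `r` by a blow-up
along `Q.comap r` (H3b, H3c); compose with `b` (`IsBlowup.exists_isBlowup_comp_supported`,
`T := Sing S`). -/
theorem admitsDesingularization_of_dim_three (hCP : CossartPiltant2019General.{u})
    (hPr : CossartPiltant2019Principalization.{u}) {R : Type u} [CommRing R]
    (hR : IsExcellentRing R) (S : Scheme.{u}) [IsIntegral S] (q : S ⟶ Spec (.of R))
    [IsSeparated q] [LocallyOfFiniteType q] [QuasiCompact q]
    (hdim : topologicalKrullDim S = 3) : Scheme.AdmitsDesingularization S := by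
  classical
  haveI : IsNoetherianRing (CommRingCat.of R) := hR.isQuasiExcellentRing.isNoetherianRing
  haveI : IsLocallyNoetherian S := LocallyOfFiniteType.isLocallyNoetherian q
  haveI : CompactSpace S := QuasiCompact.compactSpace_of_compactSpace q
  haveI : IsNoetherian S := {}
  haveI : S.IsSeparated := ⟨by rw [← terminal.comp_from q]; infer_instance⟩
  have hqe : Scheme.IsQuasiExcellent S :=
    Scheme.isQuasiExcellent_of_locallyOfFiniteType_of_isQuasiExcellentRing Stacks07QU_holds
      hR.isQuasiExcellentRing q
  -- Step 1: Cossart–Piltant 2019, Thm. 1.1: a resolution, an isomorphism over `U = Reg S`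
  obtain ⟨X'', π, hπ, U, hU, hiso⟩ := hCP S hqe hdim.le
  haveI : IsProper π := hπ.isProper
  haveI := hiso
  -- Step 2: Raynaud–Gruson (Stacks 081T + 080E): `b : S₁ → S` blow-up along `I`, `Supp I = Sing S`,
  -- dominating `X''` by a blow-up `r : S₁ → X''` along `I.comap π`
  obtain ⟨I, S₁, b, r, -, hIsupp, hb, hrb, hr⟩ :=
    exists_isBlowup_dominating π U (TopologicalSpace.NoetherianSpace.isCompact _)
  -- Step 3: Cossart–Piltant 2019, Prop. 4.4 on the regular excellent threefold `X''`
  haveI : IsLocallyNoetherian X'' := LocallyOfFiniteType.isLocallyNoetherian π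
  haveI : CompactSpace X'' := QuasiCompact.compactSpace_of_compactSpace π
  haveI : IsNoetherian X'' := {}
  haveI : IsReduced X'' := hπ.isRegular.isReduced
  haveI : IsIntegral X'' := hπ.isBirational.isIntegral
  have hexc : Scheme.IsExcellent X'' :=
    isExcellent_of_locallyOfFiniteType_of_isExcellentRing hR (π ≫ q)
  have hJ : I.comap π ≠ ⊥ := by
    -- `π` is an isomorphism over the dense open `U₀`; `U = Reg S` is a non-empty open, so some
    -- point of `X''` maps into `U`, i.e. outside `Supp I = Uᶜ`; but `Supp (I.comap π) = ⊤`.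
    intro h0
    obtain ⟨U₀, hU₀d, -, hU₀iso⟩ := hπ.isBirational
    have hne : ((U : Set S) ∩ (U₀ : Set S)).Nonempty :=
      hU₀d.inter_open_nonempty _ U.isOpen ⟨genericPoint S, by
        rw [hU]; exact genericPoint_mem_regularLocus S⟩
    obtain ⟨s, hsU, hsU₀⟩ := hne
    haveI := hU₀iso
    obtain ⟨z, hz⟩ := (ConcreteCategory.bijective_of_isIso (π ∣_ U₀).base).2 ⟨s, hsU₀⟩
    have hπz : π ((π ⁻¹ᵁ U₀).ι z) = s := by
      have := morphismRestrict_base_coe π U₀ z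
      rw [hz] at this
      exact this.symm
    have hmem : (π ⁻¹ᵁ U₀).ι z ∈ ((I.comap π).support : Set X'') := by
      rw [h0, Scheme.IdealSheafData.support_bot]; trivial
    rw [Scheme.IdealSheafData.support_comap] at hmem
    have hmem' : π ((π ⁻¹ᵁ U₀).ι z) ∈ (I.support : Set S) := hmem
    rw [hπz, hIsupp] at hmem'
    exact hmem' hsU
  have hdim'' : topologicalKrullDim X'' = 3 := by
    haveI : IsProper r := hr.isProper
    haveI : IsDominant r := (hr.isBirational' hJ).isDominant
    haveI : IsDominant π := hπ.isBirational.isDominant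
    apply le_antisymm
    · calc topologicalKrullDim X'' ≤ topologicalKrullDim S₁ :=
            Literature.AlgebraicGeometry.Motives.Scheme.topologicalKrullDim_le_of_universallyClosed_of_surjective r
        _ ≤ 3 := hb.topologicalKrullDim_le_of_isLocallyNoetherian hdim.le
    · calc (3 : WithBot ℕ∞) = topologicalKrullDim S := hdim.symm
        _ ≤ topologicalKrullDim X'' :=
            Literature.AlgebraicGeometry.Motives.Scheme.topologicalKrullDim_le_of_universallyClosed_of_surjective π
  obtain ⟨Xr, σ, hseq, hprinc⟩ := hPr X'' hπ.isRegular hexc hdim'' (I.comap π) hJ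
  have hXr : Scheme.IsRegular Xr := hseq.isRegular hπ.isRegular
  obtain ⟨_, _, hJσ⟩ := hseq.isIntegral_and_comap_ne_bot inferInstance inferInstance hJ
  haveI : IsIntegral Xr := (hseq.isIntegral_and_comap_ne_bot inferInstance inferInstance hJ).1
  -- Step 4: `σ` is ONE blow-up along `Q` with `Supp Q ⊆ Supp (I.comap π) = π⁻¹(Sing S)` (H2)
  obtain ⟨Q, hσ, hQ⟩ := exists_isBlowup_supported_of_isRegularCentreBlowupSeq hseq
  -- Step 5: `σ` factors through `r` by a blow-up `t` along `Q.comap r` (H3b, H3c)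
  have hcart : IsEffectiveCartier ((I.comap π).comap σ) :=
    isEffectiveCartier_of_isLocallyPrincipal hprinc hJσ
  obtain ⟨t, ht, htr⟩ := exists_isBlowup_factor hσ hr hcart
  -- Step 6: `t ≫ b` is a `Sing S`-supported blow-up with regular source (Raynaud)
  have hIT : (I.support : Set S) ⊆ (Scheme.regularLocus S)ᶜ := by rw [hIsupp, hU]
  have hQT : ((Q.comap r).support : Set S₁) ⊆ b ⁻¹' (Scheme.regularLocus S)ᶜ := by
    intro s hs
    rw [Scheme.IdealSheafData.support_comap] at hs
    have hs' : π (r s) ∈ (I.support : Set S) := by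
      have := hQ hs
      rwa [Scheme.IdealSheafData.support_comap] at this
    rw [← hIsupp, Set.mem_preimage, ← hrb, Scheme.Hom.comp_apply] at *
    exact hIT hs'
  obtain ⟨Q₂, hcomp, hQ₂⟩ := hb.exists_isBlowup_comp_supported b I t (Q.comap r) _ hIT ht hQT
  exact ⟨Xr, t ≫ b, ⟨Q₂, hcomp, hQ₂⟩, hXr⟩

/-! ## H4 — the local hypothesis at points of local dimension `≤ 3` -/

/-- **H4a — PROVED.** Stalks of schemes locally of finite type over a field are excellent
(copy of `isQuasiExcellentRing_stalk` with `isExcellentRing_of_finiteType_field` and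
`IsExcellentRing.of_isLocalization`). -/
theorem isExcellentRing_stalk {k : Type u} [Field k] {X : Scheme.{u}} (f : X ⟶ Spec (.of k))
    [LocallyOfFiniteType f] (x : X) : IsExcellentRing (X.presheaf.stalk x) := by
  obtain ⟨V, hV, hxV, -⟩ :=
    exists_isAffineOpen_mem_and_subset (X := X) (x := x) (U := f ⁻¹ᵁ ⊤) (by simp)
  have hφ : RingHom.FiniteType (f.appLE ⊤ V le_top).hom :=
    HasRingHomProperty.appLE @LocallyOfFiniteType f ‹_› ⟨⊤, isAffineOpen_top _⟩ ⟨V, hV⟩ le_top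
  let e : k ≃+* Γ(Spec (.of k), ⊤) := (Scheme.ΓSpecIso (.of k)).commRingCatIsoToRingEquiv.symm
  have hψ : RingHom.FiniteType (((f.appLE ⊤ V le_top).hom : _ →+* _).comp e.toRingHom) :=
    hφ.comp (RingHom.FiniteType.of_surjective _ e.surjective)
  have hΓV : IsExcellentRing Γ(X, V) := by
    letI : Algebra k Γ(X, V) := ((((f.appLE ⊤ V le_top).hom : _ →+* _).comp e.toRingHom)).toAlgebra
    haveI : Algebra.FiniteType k Γ(X, V) := hψ
    exact isExcellentRing_of_finiteType_field k Γ(X, V)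
  letI : Algebra Γ(X, V) (X.presheaf.stalk x) :=
    TopCat.Presheaf.algebra_section_stalk X.presheaf (⟨x, hxV⟩ : V)
  have hloc : IsLocalization.AtPrime (X.presheaf.stalk x) (hV.primeIdealOf ⟨x, hxV⟩).asIdeal :=
    hV.isLocalization_stalk ⟨x, hxV⟩
  exact hΓV.of_isLocalization (hV.primeIdealOf ⟨x, hxV⟩).asIdeal.primeCompl

/-- `¬ d ≤ 2 → 3 ≤ d` in `WithBot ℕ∞`. -/
theorem three_le_of_not_le_two {d : WithBot ℕ∞} (h : ¬ d ≤ 2) : 3 ≤ d := by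
  induction d using WithBot.recBotCoe with
  | bot => exact absurd bot_le h
  | coe n =>
    have h' : ¬ n ≤ 2 := fun hn => h (WithBot.coe_le_coe.mpr hn)
    have h3 : (3 : ℕ∞) ≤ n := by
      have h23 : (3 : ℕ∞) = 2 + 1 := by norm_num
      rw [h23]
      exact Order.add_one_le_of_lt (not_le.mp h')
    exact WithBot.coe_le_coe.mpr h3

/-- **H4 (M) — PROVED below.** At a point `x` of local dimension `≤ 3` of a separated `k`-scheme of
finite type, EVERY blow-up `S'` of `Spec 𝒪_{X,x}` admits a desingularization (no condition on
where `S'_sing` lies): `I = ⊥ ⇒ S' = ∅` (`IsBlowup.isEmpty_of_bot`); else `S'` is integral,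
separated, of finite type over the excellent `𝒪_{X,x}` (H4a), of dimension `≤ dim 𝒪_{X,x} ≤ 3`
(`IsBlowup.topologicalKrullDim_le_of_isLocallyNoetherian`,
`PrimeSpectrum.topologicalKrullDim_eq_ringKrullDim`); dimension `≤ 2`: the fact `hCJS`
(excellent: finite type over excellent); dimension `= 3`: H3. -/
theorem localBlowups_of_ringKrullDim_le_three (hCP : CossartPiltant2019General.{u})
    (hPr : CossartPiltant2019Principalization.{u}) (hCJS : CossartJannsenSaito2020Desing.{u})
    {k : Type u} [Field k] {X : Scheme.{u}} (f : X ⟶ Spec (.of k)) [IsIntegral X]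
    [IsSeparated f] [LocallyOfFiniteType f] [QuasiCompact f] (x : X)
    (hx : ringKrullDim (X.presheaf.stalk x) ≤ 3) (S' : Scheme.{u})
    (g : S' ⟶ Spec (X.presheaf.stalk x)) (I : (Spec (X.presheaf.stalk x)).IdealSheafData)
    (hg : IsBlowup g I) : Scheme.AdmitsDesingularization S' := by
  classical
  by_cases hI : I = ⊥
  · subst hI
    haveI := hg.isEmpty_of_bot
    exact Scheme.admitsDesingularization_of_isEmpty S'
  have hR : IsExcellentRing (X.presheaf.stalk x) := isExcellentRing_stalk f x
  haveI : IsNoetherianRing (X.presheaf.stalk x) := hR.isQuasiExcellentRing.isNoetherianRing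
  haveI : IsIntegral S' := hg.isIntegral hI
  haveI : IsProper g := hg.isProper
  have hdimS' : topologicalKrullDim S' ≤ 3 := by
    refine hg.topologicalKrullDim_le_of_isLocallyNoetherian (n := 3) ?_
    exact (le_of_eq (PrimeSpectrum.topologicalKrullDim_eq_ringKrullDim
      (R := X.presheaf.stalk x))).trans hx
  by_cases h2 : topologicalKrullDim S' ≤ 2
  · -- dimension `≤ 2`: Cossart–Jannsen–Saito, blow-up form
    haveI : IsLocallyNoetherian S' := LocallyOfFiniteType.isLocallyNoetherian g
    haveI : CompactSpace S' := QuasiCompact.compactSpace_of_compactSpace g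
    haveI : IsNoetherian S' := {}
    exact hCJS S' (isExcellent_of_locallyOfFiniteType_of_isExcellentRing hR g) h2
  · -- dimension `3`: H3
    exact admitsDesingularization_of_dim_three hCP hPr hR S' g
      (le_antisymm hdimS' (three_le_of_not_le_two h2))

/-! ## K — THE KERNEL (registered research stub; open, = CP 2019 test case at `n ≥ 4`) -/

/-- **`PicoverKernel p` — Temkin's local hypothesis at the singular points of local dimension
`≥ 4` of degree-`p` purely inseparable normalizations of regular varieties.** For `dim W = 4`
these are the singular CLOSED points `x` of `W^L`, and the statement reads: every blow-up `S'` of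
`Spec 𝒪_{W^L,x}` whose singular points lie over `x` admits a `Sing`-supported blow-up with regular
source. OPEN (Cossart–Piltant 2019, Introduction: the "test case" `h = X^p + f` over a regular
excellent local ring is solved for `n = 3` only). -/
def PicoverKernel (p : ℕ) : Prop :=
  ∀ (k : Type) [Field k] [CharP k p] (W : Scheme.{0}) [IsIntegral W] (f : W ⟶ Spec (.of k))
    (L : Type) [Field L] [Algebra W.functionField L],
    IsSeparated f → LocallyOfFiniteType f → QuasiCompact f → Scheme.IsRegular W →
    IsPurelyInseparable W.functionField L → Module.finrank W.functionField L = p →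
    ∀ x : normalizationIn W L, x ∉ Scheme.regularLocus (normalizationIn W L) →
      4 ≤ ringKrullDim ((normalizationIn W L).presheaf.stalk x) →
      ∀ (S' : Scheme.{0}) (g : S' ⟶ Spec ((normalizationIn W L).presheaf.stalk x))
        (I : (Spec ((normalizationIn W L).presheaf.stalk x)).IdealSheafData), IsBlowup g I →
        (∀ s : S', s ∉ Scheme.regularLocus S' →
          g s = closedPoint ((normalizationIn W L).presheaf.stalk x)) →
        Scheme.AdmitsDesingularization S'

/-- REGISTERED RESEARCH STUB. -/
theorem stub_picoverKernel (p : ℕ) (hp : p.Prime) : PicoverKernel p := by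
  sorry

/-! ## Assembly — the stub at `p` from the three named facts and the kernel (sorry-free, axioms propext/choice/Quot.sound) -/

/-- `¬ 4 ≤ d → d ≤ 3` in `WithBot ℕ∞`. -/
theorem le_three_of_not_four_le {d : WithBot ℕ∞} (h4 : ¬ 4 ≤ d) : d ≤ 3 := by
  have h := not_le.mp h4
  induction d using WithBot.recBotCoe with
  | bot => exact bot_le
  | coe n =>
    have h' : n < 4 := WithBot.coe_lt_coe.mp h
    have h3 : n ≤ 3 := by
      have h34 : (4 : ℕ∞) = 3 + 1 := by norm_num
      rw [h34] at h'
      exact Order.le_of_lt_add_one h'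
    exact WithBot.coe_le_coe.mpr h3

/-- **ASSEMBLY.** `stub_picoverDegP` at a prime `p`, modulo `CossartPiltant2019General`,
`CossartPiltant2019Principalization`, `CossartJannsenSaito2020Desing` and the kernel. -/
theorem stub_picoverDegP_of_kernel (hCP : CossartPiltant2019General.{0})
    (hPr : CossartPiltant2019Principalization.{0}) (hCJS : CossartJannsenSaito2020Desing.{0})
    (p : ℕ) (hp : p.Prime) (hK : PicoverKernel p) :
    ∀ (k : Type) [Field k] [CharP k p] (W : Scheme.{0}) [IsIntegral W] (f : W ⟶ Spec (.of k))
      (L : Type) [Field L] [Algebra W.functionField L], IsSeparated f → LocallyOfFiniteType f →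
      QuasiCompact f → Scheme.IsRegular W → IsPurelyInseparable W.functionField L →
      Module.finrank W.functionField L = p → Scheme.HasResolution (normalizationIn W L) := by
  intro k _ _ W _ f L _ _ hsep hlft hqc hreg hpi hdeg
  haveI : FiniteDimensional W.functionField L :=
    Module.finite_of_finrank_pos (by rw [hdeg]; exact hp.pos)
  haveI : IsSeparated f := hsep
  haveI : LocallyOfFiniteType f := hlft
  haveI : QuasiCompact f := hqc
  haveI : IsFinite (normalizationInι W L) := isFinite_normalizationInι W L f
  haveI : IsSeparated (normalizationInι W L ≫ f) := inferInstance
  haveI : LocallyOfFiniteType (normalizationInι W L ≫ f) := inferInstance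
  haveI : QuasiCompact (normalizationInι W L ≫ f) := inferInstance
  haveI : IsNoetherianRing (CommRingCat.of k) := inferInstanceAs (IsNoetherianRing k)
  haveI : IsNoetherian (Spec (CommRingCat.of k)) := {}
  have hqe : Scheme.IsQuasiExcellent (Spec (CommRingCat.of k)) :=
    Scheme.isQuasiExcellent_of_locallyOfFiniteType_of_isQuasiExcellentRing Stacks07QU_holds
      (isQuasiExcellentRing_of_field k) (𝟙 _)
  have hX : Scheme.AdmitsDesingularization (normalizationIn W L) := by
    refine admitsDesingularization_of_localBlowups hqe (normalizationInι W L ≫ f) ?_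
    intro x hx S' g I hg hsing
    by_cases h4 : 4 ≤ ringKrullDim ((normalizationIn W L).presheaf.stalk x)
    · exact hK k W f L hsep hlft hqc hreg hpi hdeg x hx h4 S' g I hg hsing
    · exact localBlowups_of_ringKrullDim_le_three hCP hPr hCJS (normalizationInι W L ≫ f) x
        (le_three_of_not_four_le h4) S' g I hg
  haveI : IsLocallyNoetherian (normalizationIn W L) :=
    LocallyOfFiniteType.isLocallyNoetherian (normalizationInι W L ≫ f)
  exact hX.hasResolution

end Summit.ResolutionOfSingularities.ResolutionOfSingularities.Cruxes.Picover.StubPlan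

end
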